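import Literature.Analysis.FluidPDE.LocalLerayWeakStrongViscosity
import HarnessLib

/-!
# The far-field `L^∞` bound of local Leray solutions at every viscosity
(Lemarié-Rieusset 2016, proof of Thm. 14.5 / proof of Thm. 15.4, Step 2)

Analysis/FluidPDE glue file (no definitions, no named facts) below the named fact
`Literature.Analysis.FluidPDE.localLeray_farField_vorticity_regular`
(`NSLocalLerayFarFieldVorticity.lean`; Lemarié-Rieusset, *The Navier–Stokes Problem in the 21st
Century* (2016), doi:10.1201/b19556, proof of Thm. 15.4, Step 2, PDF p. 569: "there exists some
`R > 0` and `M > 0` such that `|u(t,x)| ≤ M` on `(T₄/2, T₁) × (ℝ³ ∖ B(0,R))`", for a local Leray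
solution with `L³` datum **and viscosity `ν > 0`**). The tree carries this far-field bound as
the named fact **F** `leray_solution_farField_bound` (`LerayFarFieldRegularity.lean`) at unit
viscosity only (the sources normalise `ν = 1`); this file proves the general-viscosity form from
**F** by the viscosity scaling of the local Leray class:

* `leray_solution_farField_bound_of_viscosity :
    leray_solution_farField_bound → (ν > 0, u₀ ∈ L³ weakly div-free,
    IsLocalLeraySolution ν u₀ v π, 0 < t₁ < t₂) → ∃ R, v ∈ L^∞((t₁, t₂) × {|x| > R})` —
  normalise `ṽ = ν⁻¹ v(ν⁻¹ ·, ·)` (`IsLocalLeraySolution.toUnitViscosity`, datum `ν⁻¹ u₀ ∈ L³`),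
  apply **F** on the window `(ν t₁, ν t₂)`, and pull the essential bound back along
  `Φ(s, y) = (ν s, y)`, which maps `(t₁, t₂) × {|x| > R}` onto `(ν t₁, ν t₂) × {|x| > R}` and
  multiplies the essential supremum by `ν` (`eLpNorm_top_comp_stAffine_restrict_preimage`) —
  the bookkeeping of `IsKatoSolutionOn.farField_bound_of_leray_theory` (ibid.) for the Leray
  solution itself instead of the Kato solution.

## References

* P. G. Lemarié-Rieusset, *The Navier–Stokes Problem in the 21st Century* (2016),
  doi:10.1201/b19556: proof of Thm. 15.4, Step 2 (PDF p. 569); Thm. 14.5 and its proof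
  (PDF pp. 510–511); 2nd ed., proof of Thm. 15.1 (C) (PDF p. 566).
* W. Rusin, V. Šverák, J. Funct. Anal. 260 (2011) = arXiv:0911.0500, §1 p. 3 (unit viscosity).
-/

noncomputable section

open _root_.MeasureTheory _root_.TopologicalSpace _root_.Metric _root_.Filter _root_.Set
  _root_.Function
open scoped _root_.ENNReal _root_.NNReal _root_.Topology

namespace Literature.Analysis.FluidPDE

/-- **Far-field `L^∞` bound of local Leray solutions with `L³` data at viscosity `ν > 0`**
(Lemarié-Rieusset 2016, proof of Thm. 15.4, Step 2, PDF p. 569: "there exists some `R > 0` and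
`M > 0` such that `|u(t,x)| ≤ M` on `(T₄/2, T₁) × (ℝ³ ∖ B(0,R))`"; proof of Thm. 14.5,
pp. 510–511), **from the unit-viscosity fact `leray_solution_farField_bound`**: for a weakly
divergence-free `u₀ ∈ L³`, a local Leray solution `(v, π)` with viscosity `ν` and datum `u₀`,
and `0 < t₁ < t₂`, there is `R` with `v` essentially bounded on `(t₁, t₂) × {|x| > R}`.
Normalise to unit viscosity (`ṽ = ν⁻¹ v(ν⁻¹ ·, ·)`, datum `ν⁻¹ u₀`), apply the fact on
`(ν t₁, ν t₂)`, undo the scaling (`v = ν ṽ ∘ Φ`, `Φ(s, y) = (ν s, y)`).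
[cite: LemarieRieusset2016, proof of Thm. 15.4, Step 2 (PDF p. 569), with the proof of Thm. 14.5 (pp. 510–511)] -/
theorem leray_solution_farField_bound_of_viscosity (hF : leray_solution_farField_bound) {ν : ℝ}
    (hν : 0 < ν) {u₀ : EuclideanSpace ℝ (Fin 3) → EuclideanSpace ℝ (Fin 3)}
    (hu₀ : MemLp u₀ 3 volume) (hdiv : IsWeaklyDivFree u₀)
    {v : ℝ → EuclideanSpace ℝ (Fin 3) → EuclideanSpace ℝ (Fin 3)}
    {π : ℝ → EuclideanSpace ℝ (Fin 3) → ℝ} (hv : IsLocalLeraySolution ν u₀ v π) {t₁ t₂ : ℝ}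
    (ht₁ : 0 < t₁) (ht₁₂ : t₁ < t₂) :
    ∃ R : ℝ, eLpNorm (uncurry v) ∞
      (volume.restrict (Ioo t₁ t₂ ×ˢ (closedBall (0 : (EuclideanSpace ℝ (Fin 3))) R)ᶜ)) < ∞ := by
  -- normalise the viscosity
  have hv' := hv.toUnitViscosity hν
  have h3 : MemLp (ν⁻¹ • u₀) 3 volume := hu₀.const_smul _
  have hdiv' : IsWeaklyDivFree (ν⁻¹ • u₀) := hdiv.const_smul _
  -- the unit-viscosity fact on the window `(ν t₁, ν t₂)`
  obtain ⟨R, hR⟩ := hF _ h3 hdiv' _ _ hv' (ν * t₁) (ν * t₂) (mul_pos hν ht₁)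
    (mul_lt_mul_of_pos_left ht₁₂ hν)
  refine ⟨R, ?_⟩
  -- undo the scaling
  rw [uncurry_eq_smul_timeRescale_comp_stAffine hν.ne' v, eLpNorm_const_smul,
    ← stAffine_preimage_Ioo_prod hν t₁ t₂ (closedBall (0 : (EuclideanSpace ℝ (Fin 3))) R)ᶜ,
    eLpNorm_top_comp_stAffine_restrict_preimage hν one_pos 0 (0 : (EuclideanSpace ℝ (Fin 3))) _
      (Ioo (ν * t₁) (ν * t₂) ×ˢ (closedBall (0 : (EuclideanSpace ℝ (Fin 3))) R)ᶜ)]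
  exact ENNReal.mul_lt_top enorm_lt_top hR

/-- The same bound, as an explicit essential-supremum constant: there are `R` and `M` with
`‖v(t, x)‖ ≤ M` for a.e. `(t, x) ∈ (t₁, t₂) × {|x| > R}` (Lemarié-Rieusset 2016, proof of
Thm. 15.4, Step 2, p. 569: "`|u(t,x)| ≤ M`"). [cite: LemarieRieusset2016, proof of Thm. 15.4, Step 2 (PDF p. 569)] -/
theorem leray_solution_farField_ae_bound_of_viscosity (hF : leray_solution_farField_bound) {ν : ℝ}
    (hν : 0 < ν) {u₀ : EuclideanSpace ℝ (Fin 3) → EuclideanSpace ℝ (Fin 3)}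
    (hu₀ : MemLp u₀ 3 volume) (hdiv : IsWeaklyDivFree u₀)
    {v : ℝ → EuclideanSpace ℝ (Fin 3) → EuclideanSpace ℝ (Fin 3)}
    {π : ℝ → EuclideanSpace ℝ (Fin 3) → ℝ} (hv : IsLocalLeraySolution ν u₀ v π) {t₁ t₂ : ℝ}
    (ht₁ : 0 < t₁) (ht₁₂ : t₁ < t₂) :
    ∃ R M : ℝ,
      ∀ᵐ z ∂(volume.restrict (Ioo t₁ t₂ ×ˢ (closedBall (0 : EuclideanSpace ℝ (Fin 3)) R)ᶜ)),
        ‖uncurry v z‖ ≤ M := by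
  obtain ⟨R, hR⟩ := leray_solution_farField_bound_of_viscosity hF hν hu₀ hdiv hv ht₁ ht₁₂
  refine ⟨R, (eLpNorm (uncurry v) ∞
    (volume.restrict (Ioo t₁ t₂ ×ˢ (closedBall (0 : (EuclideanSpace ℝ (Fin 3))) R)ᶜ))).toReal, ?_⟩
  have h := ae_le_eLpNormEssSup (f := uncurry v)
    (μ := volume.restrict (Ioo t₁ t₂ ×ˢ (closedBall (0 : EuclideanSpace ℝ (Fin 3)) R)ᶜ))
  filter_upwards [h] with z hz
  rw [← eLpNorm_exponent_top] at hz
  have hfin : eLpNorm (uncurry v) ∞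
      (volume.restrict (Ioo t₁ t₂ ×ˢ (closedBall (0 : EuclideanSpace ℝ (Fin 3)) R)ᶜ)) ≠ ∞ :=
    hR.ne
  calc ‖uncurry v z‖ = (‖uncurry v z‖ₑ).toReal := by simp
    _ ≤ _ := (ENNReal.toReal_le_toReal enorm_ne_top hfin).2 hz

end Literature.Analysis.FluidPDE

end
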